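import Summits.QuantumFields.BalabanUV.T4Continuum.Support.B13AssemblyCoresEndSubstrate

/-!
# B13AssemblyCoresEndSubstrateAmbient — row O1-d2-ii «act instance», follower 2∕2: THE (2.14)-FACTOR-CORE END OF RECORD AT THE SUBSTRATE's
# SLOTS OF RECORD ON `measOp` WITH THE FACTOR-LETTER BINDERS IN **AMBIENT-BALL FORM** — stated on the balls of the FULL datum space
# `OpDatum (SpeciesRec …)` about run B's datum of record, for the letters as functions on `OpDatum` (the currency in which the substrate's S-U3
# suppliers `SubstrateGaussianLettersBall.differentiableOn_gaussN_linForm ∕ norm_gaussN_linForm_le` and `SubstrateGaussianLetters.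
# aestronglyMeasurable_gaussQ ∕ differentiableOn_gaussQ ∕ margin_gaussQ_linForm` are printed), TRANSFERRED to the sub-slot balls of module 1 by this
# lineage's p220771 §1c helpers `mem_ball_mk_iff` ∕ `differentiableOn_coe_of_ball` (the inclusion `↥measOp → OpDatum` is an isometry)
# (cell `pub-balaban`, T⁴ fan-out, row NE5; unit `b2b-balaban-t4-ne5-formalise-leaf-08`, gen 6)

HONEST FRAMING (T4-DAG PAGE 1).  Rung (B)+1 on ONE finite four-torus of fixed physical size — NOT infinite volume, NOT a mass gap, NOT
the Clay problem; `FlowStep.BetaPertH`, (B), (B^μ) do not occur here.  NE5 (`T4OutputRate.NE5`) is NOT PRINTED and NOT PROVED (spine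
0/9, unchanged): the END below is an IMPLICATION from displayed binders — «NE5 ⇐ the instance» (trigger c5), NOT «NE5 proved».  The O1
INSTANCE is the SUBSTRATE cell's (Q-NE9-O1, DESIGN RULE R34); this file asserts NOTHING about the substrate's letters and discharges NONE of
the factor-letter clauses — it only RE-STATES them in the form the substrate's lemmas conclude, so that their discharge (S-U3: which tables
`base ∕ rd ∕ coords` realise `C^{(k)}(Z₀,σ)`, `Γ_k` of [Balaban1988RG2Cluster] (2.14) p. 15; the radius smallness `detBudget < d₀`,
`card·ϑ·R′ < γ`) is a direct application.  0 cite tags; printed KIND only; 0 `def`.  HONEST DEPENDENCY (cell, verbatim): continuum YM on T⁴ ⇐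
BetaPertH ∧ nine spine estimates (0/9 proved); BetaPertH ⇐ (D1) ∧ (D4) ∧ CAP+tail; G-an2-4 gates asym, D1 and NE2/3/4.

WHAT THIS MODULE IS (bookkeeping ∕ [folklore]; two applications BY NAME after a pointwise transfer; no estimate):
* §1 **`ne5_substrate_cores_actNorm_ambient`** — module 1's `B13AssemblyCoresEndSubstrate.ne5_substrate_cores_actNorm` with its two factor-letter
  binders `hNf` ∕ `hqf` REPLACED by their AMBIENT-BALL forms: for every level `k`, `g ∈ W`, run-B background `U`, domain `X` of scale `k`, term `i`
  related to `X` and factor `m`, ON THE BALL `ball (opOf (slotsOfRecord …).F (slotsOfRecord …).rawB g U k) (R′ k)` OF `OpDatum (SpeciesRec …)`: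
  a.e.-strong measurability of `N op` ∕ `uncurry (q op)`, holomorphy of `op ↦ N op p` ∕ `op ↦ q op p v` AS FUNCTIONS ON `OpDatum`, the bound
  `‖N op p‖ ≤ N₀f` and the margin `mf·‖v‖² − bf ≤ Re (q op p v)` (by `coresRec_N ∕ _q` these are clauses about `gaussN ∕ gaussQ (linForm base rd)`).
  TRANSFER (proof): a point `op : ↥measOp` of the sub-slot ball has `↑op` in the ambient ball (`mem_ball_mk_iff`), and holomorphy on the ambient
  ball restricts along the inclusion (`differentiableOn_coe_of_ball`); every other binder and the conclusion VERBATIM as in module 1: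
  `T4OutputRate.NE5 (B13StepOfRecord.outA (slotsOfRecord …) E₀ cB) (B13StepOfRecord.outB (slotsOfRecord …) E₀ cB) W κ θ′ C₅`, the diamond's `C₅`.
* §2 **`exists_ne5_substrate_cores_actNorm_ambient`** — the chained face (module 1 §2) the same way ⟹ `∃ C₅, NE5 …`.
CENSUS vs module 1 §1 ∕ §2 (binders, by name): MINUS = ∅; PLUS = ∅; CHANGED = [hNf, hqf] (sub-slot balls of `↥measOp` read at `↑op` ↦ ambient
balls of `OpDatum (SpeciesRec …)`; the ambient forms are STRONGER hypotheses clause by clause, so nothing is weakened); rest IDENTICAL.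
STATUS (census, Edison rule).  DISPLAYED: the same list as module 1, the factor letters now in the substrate's own ambient currency.  NOTHING of
Bałaban's (2.14) data is asserted; 0/12 leaves; NE5 NOT PROVED; spine 0/9; rung (B)+1 finite T⁴; NOT infinite volume ∕ mass gap ∕ Clay.
0 sorry; axioms ⊆ {propext, Classical.choice, Quot.sound}.
-/

noncomputable section

open scoped BigOperators
open Metric MeasureTheory

namespace Summit.QuantumFields.BalabanUV.T4Continuum.B13AssemblyCoresEndSubstrateAmbient

open Literature.MathematicalPhysics.QuantumFieldTheory.Balaban1983to89
open Literature.MathematicalPhysics.QuantumFieldTheory.Balaban1983to89.T4OutputRate (DecayBound NE5)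
open Literature.MathematicalPhysics.QuantumFieldTheory.Balaban1983to89.B5Prop11Plancherel (Tor)
open Summit.QuantumFields.BalabanUV.T4Continuum.B13OpDatum (OpDatum FormatBounded)
open Summit.QuantumFields.BalabanUV.T4Continuum.B13OpDatumJunctions (opOf RawBounded WeightedEntrywiseRate)
open Summit.QuantumFields.BalabanUV.T4Continuum.B13StepTermLabels (InnerLabel)
open Summit.QuantumFields.BalabanUV.T4Continuum.B13InnerData (Bnd b13InnerData)
open Summit.QuantumFields.BalabanUV.T4Continuum.B13HistMeasurable (MeasPotFrame B13HistM)
open Summit.QuantumFields.BalabanUV.T4Continuum.B13TermCoreFamily (factorCores)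
open Summit.QuantumFields.BalabanUV.T4Continuum.B13TermCoreMass (factorMass)
open Summit.QuantumFields.BalabanUV.T4Continuum.UrsellTreeSum (ind)
open Summit.QuantumFields.BalabanUV.T4Continuum.UrsellTermBudget (actSum)
open Summit.QuantumFields.BalabanUV.T4Continuum.B13DomainGeometryTR (SCube footprint)
open Summit.QuantumFields.BalabanUV.T4Continuum.B13StepOfRecord (assembly step)
open Summit.QuantumFields.BalabanUV.T4Continuum.SubstrateBackgroundTransporters (unitMod)
open Summit.QuantumFields.BalabanUV.T4Continuum.SubstrateTwoRunsDriven (DrivenRuns)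
open Summit.QuantumFields.BalabanUV.T4Continuum.SubstrateRawSpecies (rawAOfRecord rawBOfRecord)
open Summit.QuantumFields.BalabanUV.T4Continuum.SubstrateSlotsOfRecord (SpeciesRec SlotLetters slotsOfRecord)
open Summit.QuantumFields.BalabanUV.T4Continuum.B13AssemblyCoresEndRestrictRecord (coresRec)
open Summit.QuantumFields.BalabanUV.T4Continuum.B13AssemblyCoresEndRestrict (mem_ball_mk_iff differentiableOn_coe_of_ball)
open Summit.QuantumFields.BalabanUV.T4Continuum.B13AssemblyCoresEndSubstrate (ne5_substrate_cores_actNorm exists_ne5_substrate_cores_actNorm)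

variable {G : Type} [GaugeGroup G] (D : DrivenRuns G)
variable {o : Type} [Fintype o] [DecidableEq o] (ι : G →* Matrix o o ℂ) (c : ℂ) (a : ℝ) (s : ℕ → ℂ)
variable {T ι' S Ω 𝒴 : Type} [MeasurableSpace Ω] (P : MeasPotFrame D.carriers) {IOp : Type*}
  (𝒵 : D.carriers.Dom → InnerLabel D.carriers.Dom (Bnd D.toTwoRuns) → Type) [∀ Z j, Fintype (𝒵 Z j)] (dom : ∀ Z j, 𝒵 Z j → D.carriers.Dom)
  (Jc : D.carriers.Dom → InnerLabel D.carriers.Dom (Bnd D.toTwoRuns) → Type) [∀ Z j, Fintype (Jc Z j)]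
  (V : D.carriers.Dom → InnerLabel D.carriers.Dom (Bnd D.toTwoRuns) → Type) [∀ Z j, NormedAddCommGroup (V Z j)]
  [∀ Z j, InnerProductSpace ℝ (V Z j)] [∀ Z j, MeasurableSpace (V Z j)] [∀ Z j, BorelSpace (V Z j)] [∀ Z j, FiniteDimensional ℝ (V Z j)]
  (mI : D.carriers.Dom → InnerLabel D.carriers.Dom (Bnd D.toTwoRuns) → Type) [∀ Z j, Fintype (mI Z j)] [∀ Z j, DecidableEq (mI Z j)]
  (L : SlotLetters D (o := o) (T := T) (ι' := ι') (S := S) (Ω := Ω) (𝒴 := 𝒴) P (IOp := IOp) 𝒵 dom Jc V mI)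

section Instance

variable
  -- p221190 §1's letter conditions (replace `hMA` ∕ `hMB` at `M := measOp`)
  (hbdA : ∀ (g : ℕ → ℝ) (U : D.carriers.BgA) (k : ℕ),
    FormatBounded (L.W k).format (rawAOfRecord ι D c a s L.ΓA L.dkA L.gcA L.pQA L.pRA g U k).kernel)
  (hmQA : ∀ (r : ℝ) (U : GaugeField (D.F.P D.K) 0 G) (k : ℕ) (Y : 𝒴) (b b' : ((Tor (unitMod (D.F.P D.K)) × Fin (D.F.P D.K).d) × o)),
    Measurable fun x : Ω => L.pQA r U k x Y b b')
  (hmRA : ∀ (r : ℝ) (U : GaugeField (D.F.P D.K) 0 G) (k : ℕ) (Y : 𝒴), Measurable fun x : Ω => L.pRA r U k x Y)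
  (hbdB : ∀ (g : ℕ → ℝ) (U : D.carriers.BgB) (k : ℕ),
    FormatBounded (L.W k).format (rawBOfRecord ι D c a s L.ΓB L.dkB L.gcB L.pQB L.pRB g U k).kernel)
  (hmQB : ∀ (r : ℝ) (U : GaugeField (D.F.P (D.K + 1)) 0 G) (k : ℕ) (Y : 𝒴) (b b' : ((Tor (unitMod (D.F.P D.K)) × Fin (D.F.P D.K).d) × o)),
    Measurable fun x : Ω => L.pQB r U k x Y b b')
  (hmRB : ∀ (r : ℝ) (U : GaugeField (D.F.P (D.K + 1)) 0 G) (k : ℕ) (Y : 𝒴), Measurable fun x : Ω => L.pRB r U k x Y)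
  -- p221190 §2's factorisation datum (replaces `hT`)
  (iopAt : ℝ → D.carriers.BgA → ℕ → IOp)
  (hiopA : ∀ (r : ℝ) (U : D.carriers.BgB) (k : ℕ), L.ins.iopA r U k = iopAt r (D.carriers.transport U) k)
  (E₀ cB : ℝ)

/-! ## §1 The (2.14)-factor-core END of record at the substrate's slots of record on `measOp`, factor letters in ambient-ball form -/

include hbdA hmQA hmRA hbdB hmQB hmRB hiopA in
/-- [folklore] **THE (2.14)-FACTOR-CORE END OF RECORD AT THE SUBSTRATE's SLOTS OF RECORD ON `measOp`, FACTOR LETTERS IN AMBIENT-BALL FORM** —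
module 1's `ne5_substrate_cores_actNorm` with `hNf` ∕ `hqf` stated on the balls `ball (opOf (slotsOfRecord …).F (slotsOfRecord …).rawB g U k) (R′ k)` of
the FULL datum space `OpDatum (SpeciesRec …)` for the letters `N` ∕ `q` as functions on `OpDatum` (the substrate's S-U3 currency; by `coresRec_N ∕ _q`
clauses about `gaussN ∕ gaussQ (linForm base rd)`), transferred to the `measOp`-balls pointwise (`mem_ball_mk_iff`) and along the inclusion
(`differentiableOn_coe_of_ball`).  Every other binder VERBATIM; conclusion LITERALLY `T4OutputRate.NE5 (B13StepOfRecord.outA (slotsOfRecord …) E₀ cB)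
(B13StepOfRecord.outB (slotsOfRecord …) E₀ cB) W κ θ′ C₅`, the diamond's `C₅`.  «NE5 ⇐ the instance» — NOT NE5 proved; no letter of the substrate
asserted, no factor-letter clause discharged. -/
theorem ne5_substrate_cores_actNorm_ambient {W : Set (ℕ → ℝ)} {ROp RHist R' H : ℕ → ℝ}
    {N₀f mf bf : D.carriers.Dom → InnerLabel D.carriers.Dom (Bnd D.toTwoRuns) → ℝ}
    {A' : ℕ → D.carriers.Dom → InnerLabel D.carriers.Dom (Bnd D.toTwoRuns) → ℝ}
    {mstar κ Φ' EA₀ E₁ cA c₁ r₀ δ' θ θ' ρ₀ B : ℝ} {k₀ : ℕ}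
    (hbB : (assembly (slotsOfRecord D ι c a s P 𝒵 dom Jc V mI L)).SliceBudgetB W κ cB)
    (hbA : (slotsOfRecord D ι c a s P 𝒵 dom Jc V mI L).D.SliceBudget (step (slotsOfRecord D ι c a s P 𝒵 dom Jc V mI L) E₀ cB) W κ cA)
    (hdA : DecayBound (B13StepOfRecord.outA (slotsOfRecord D ι c a s P 𝒵 dom Jc V mI L) E₀ cB) W EA₀ κ)
    (hdB : DecayBound (B13StepOfRecord.outB (slotsOfRecord D ι c a s P 𝒵 dom Jc V mI L) E₀ cB) W E₀ κ)
    (hRA : RawBounded (slotsOfRecord D ι c a s P 𝒵 dom Jc V mI L).F (assembly (slotsOfRecord D ι c a s P 𝒵 dom Jc V mI L)).rawAt W)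
    (hRB : RawBounded (slotsOfRecord D ι c a s P 𝒵 dom Jc V mI L).F (slotsOfRecord D ι c a s P 𝒵 dom Jc V mI L).rawB W)
    (hwer : WeightedEntrywiseRate (slotsOfRecord D ι c a s P 𝒵 dom Jc V mI L).F (assembly (slotsOfRecord D ι c a s P 𝒵 dom Jc V mI L)).rawAt
      (slotsOfRecord D ι c a s P 𝒵 dom Jc V mI L).rawB W c₁ fun k => θ ^ k)
    (hfl : ∀ k, r₀ ≤ L.rOp k)
    (hins : (step (slotsOfRecord D ι c a s P 𝒵 dom Jc V mI L) E₀ cB).InsertionRate W κ E₀ δ' θ)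
    (hOp : ∀ k, L.rOp k ≤ ROp k) (hroom : ∀ k, ROp k < R' k)
    (hHist : ∀ k, (assembly (slotsOfRecord D ι c a s P 𝒵 dom Jc V mI L)).bHist E₀ cB k + L.rHist k ≤ RHist k)
    -- the factor letters in the substrate's currency, ON THE AMBIENT BALLS of `OpDatum (SpeciesRec …)`
    (hm : 0 < mstar) (hmf : ∀ Z ℓ, mstar ≤ mf Z ℓ) (hN₀ : ∀ Z ℓ, 0 ≤ N₀f Z ℓ)
    (hNf : ∀ k, ∀ g ∈ W, ∀ (U : D.carriers.BgB) (X : D.carriers.Dom), D.carriers.scale X = k →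
      ∀ i, (assembly (slotsOfRecord D ι c a s P 𝒵 dom Jc V mI L)).𝒯.Rel k i X →
      ∀ m : Fin ((assembly (slotsOfRecord D ι c a s P 𝒵 dom Jc V mI L)).𝒯.len i + 1),
      (∀ op ∈ ball (opOf (slotsOfRecord D ι c a s P 𝒵 dom Jc V mI L).F (slotsOfRecord D ι c a s P 𝒵 dom Jc V mI L).rawB g U k) (R' k),
        AEStronglyMeasurable ((factorCores (assembly (slotsOfRecord D ι c a s P 𝒵 dom Jc V mI L)).𝒯 (coresRec D P 𝒵 dom Jc V mI L) i m).N
          op) (factorCores (assembly (slotsOfRecord D ι c a s P 𝒵 dom Jc V mI L)).𝒯 (coresRec D P 𝒵 dom Jc V mI L) i m).lam) ∧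
      (∀ p, DifferentiableOn ℂ (fun op : OpDatum (SpeciesRec D o T ι' Ω 𝒴) =>
          (factorCores (assembly (slotsOfRecord D ι c a s P 𝒵 dom Jc V mI L)).𝒯 (coresRec D P 𝒵 dom Jc V mI L) i m).N op p)
        (ball (opOf (slotsOfRecord D ι c a s P 𝒵 dom Jc V mI L).F (slotsOfRecord D ι c a s P 𝒵 dom Jc V mI L).rawB g U k) (R' k))) ∧
      (∀ op ∈ ball (opOf (slotsOfRecord D ι c a s P 𝒵 dom Jc V mI L).F (slotsOfRecord D ι c a s P 𝒵 dom Jc V mI L).rawB g U k) (R' k), ∀ p,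
        ‖(factorCores (assembly (slotsOfRecord D ι c a s P 𝒵 dom Jc V mI L)).𝒯 (coresRec D P 𝒵 dom Jc V mI L) i m).N op p‖ ≤
          N₀f ((assembly (slotsOfRecord D ι c a s P 𝒵 dom Jc V mI L)).𝒯.poly i m)
            ((assembly (slotsOfRecord D ι c a s P 𝒵 dom Jc V mI L)).𝒯.lab i m)))
    (hqf : ∀ k, ∀ g ∈ W, ∀ (U : D.carriers.BgB) (X : D.carriers.Dom), D.carriers.scale X = k →
      ∀ i, (assembly (slotsOfRecord D ι c a s P 𝒵 dom Jc V mI L)).𝒯.Rel k i X →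
      ∀ m : Fin ((assembly (slotsOfRecord D ι c a s P 𝒵 dom Jc V mI L)).𝒯.len i + 1),
      (∀ op ∈ ball (opOf (slotsOfRecord D ι c a s P 𝒵 dom Jc V mI L).F (slotsOfRecord D ι c a s P 𝒵 dom Jc V mI L).rawB g U k) (R' k),
        AEStronglyMeasurable (Function.uncurry
          ((factorCores (assembly (slotsOfRecord D ι c a s P 𝒵 dom Jc V mI L)).𝒯 (coresRec D P 𝒵 dom Jc V mI L) i m).q op))
          ((factorCores (assembly (slotsOfRecord D ι c a s P 𝒵 dom Jc V mI L)).𝒯 (coresRec D P 𝒵 dom Jc V mI L) i m).lam.prod volume)) ∧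
      (∀ p v, DifferentiableOn ℂ (fun op : OpDatum (SpeciesRec D o T ι' Ω 𝒴) =>
          (factorCores (assembly (slotsOfRecord D ι c a s P 𝒵 dom Jc V mI L)).𝒯 (coresRec D P 𝒵 dom Jc V mI L) i m).q op p v)
        (ball (opOf (slotsOfRecord D ι c a s P 𝒵 dom Jc V mI L).F (slotsOfRecord D ι c a s P 𝒵 dom Jc V mI L).rawB g U k) (R' k))) ∧
      (∀ op ∈ ball (opOf (slotsOfRecord D ι c a s P 𝒵 dom Jc V mI L).F (slotsOfRecord D ι c a s P 𝒵 dom Jc V mI L).rawB g U k) (R' k), ∀ p v,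
        mf ((assembly (slotsOfRecord D ι c a s P 𝒵 dom Jc V mI L)).𝒯.poly i m) ((assembly (slotsOfRecord D ι c a s P 𝒵 dom Jc V mI L)).𝒯.lab i m) *
            ‖v‖ ^ 2 -
          bf ((assembly (slotsOfRecord D ι c a s P 𝒵 dom Jc V mI L)).𝒯.poly i m) ((assembly (slotsOfRecord D ι c a s P 𝒵 dom Jc V mI L)).𝒯.lab i m) ≤
          ((factorCores (assembly (slotsOfRecord D ι c a s P 𝒵 dom Jc V mI L)).𝒯 (coresRec D P 𝒵 dom Jc V mI L) i m).q op p v).re))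
    (hH : ∀ k, ∀ g ∈ W, ∀ U : D.carriers.BgB, ‖(assembly (slotsOfRecord D ι c a s P 𝒵 dom Jc V mI L)).histRef g U k‖ + RHist k ≤ H k)
    -- the stripped majorant's decay split and anchored exponential norm
    (hκ : 0 ≤ κ) (hA0' : ∀ k Z ℓ, 0 ≤ A' k Z ℓ)
    (hdec : ∀ k Z ℓ, factorMass (coresRec D P 𝒵 dom Jc V mI L) N₀f bf mstar (H k) Z ℓ ≤ A' k Z ℓ * Real.exp (-(κ * (D.carriers.d Z + 5))))
    (hΦ0 : 0 ≤ Φ') (hsmallΦ : 36 * Φ' < 1)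
    (hΦ : ∀ (k : ℕ) (q : SCube D.toTwoRuns), ∑ Z ∈ D.toTwoRuns.domAt k,
      ind (q ∈ footprint Z) * actSum (b13InnerData D.toTwoRuns) (A' k) k Z * Real.exp ((footprint Z).card) ≤ Φ')
    (hE₀ : 0 ≤ E₀) (hE₁ : 0 < E₁) (hcA : 0 ≤ cA) (hcB : 0 ≤ cB) (hc₁ : 0 ≤ c₁) (hr₀ : 0 < r₀) (hδ' : 0 ≤ δ')
    (hθ : 0 ≤ θ) (hθθ' : θ ≤ θ') (hθ'1 : θ' ≤ 1) (hω : 0 < L.ins.ω) (hω1 : L.ins.ω < 1) (hρ₀ : ρ₀ < 1)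
    (hnear : (c₁ / r₀ + δ') * θ ^ k₀ + cA * (EA₀ + E₀) / (1 - L.ins.ω) ≤ ρ₀) (hB : 0 ≤ B)
    (hfirst : ∀ k < k₀, EA₀ + E₀ ≤ B * θ ^ k)
    (hsmall : L.ins.ω + Φ' / (1 - 36 * Φ') / (1 - ρ₀) * cA < θ') :
    NE5 (B13StepOfRecord.outA (slotsOfRecord D ι c a s P 𝒵 dom Jc V mI L) E₀ cB)
      (B13StepOfRecord.outB (slotsOfRecord D ι c a s P 𝒵 dom Jc V mI L) E₀ cB) W κ θ'
      ((Φ' / (1 - 36 * Φ') / (1 - ρ₀) * (c₁ / r₀) + Φ' / (1 - 36 * Φ') / (1 - ρ₀) * δ' + B) * (θ' - L.ins.ω) /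
        (θ' - (L.ins.ω + Φ' / (1 - 36 * Φ') / (1 - ρ₀) * cA))) :=
  ne5_substrate_cores_actNorm D ι c a s P 𝒵 dom Jc V mI L hbdA hmQA hmRA hbdB hmQB hmRB iopAt hiopA E₀ cB hbB hbA hdA hdB hRA hRB hwer hfl
    hins hOp hroom hHist hm hmf hN₀
    (fun k g hg U X hX i hi m => by
      obtain ⟨h₁, h₂, h₃⟩ := hNf k g hg U X hX i hi m
      exact ⟨fun op hop => h₁ _ ((mem_ball_mk_iff _ _ op).1 hop), fun p => differentiableOn_coe_of_ball _ _ (h₂ p),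
        fun op hop p => h₃ _ ((mem_ball_mk_iff _ _ op).1 hop) p⟩)
    (fun k g hg U X hX i hi m => by
      obtain ⟨h₁, h₂, h₃⟩ := hqf k g hg U X hX i hi m
      exact ⟨fun op hop => h₁ _ ((mem_ball_mk_iff _ _ op).1 hop), fun p v => differentiableOn_coe_of_ball _ _ (h₂ p v),
        fun op hop p v => h₃ _ ((mem_ball_mk_iff _ _ op).1 hop) p v⟩)
    hH hκ hA0' hdec hΦ0 hsmallΦ hΦ hE₀ hE₁ hcA hcB hc₁ hr₀ hδ' hθ hθθ' hθ'1 hω hω1 hρ₀ hnear hB hfirst hsmall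

/-! ## §2 The chained face, factor letters in ambient-ball form -/

include hbdA hmQA hmRA hbdB hmQB hmRB hiopA in
/-- [folklore] **THE CHAINED (2.14)-FACTOR-CORE END OF RECORD AT THE SUBSTRATE's SLOTS OF RECORD ON `measOp`, FACTOR LETTERS IN AMBIENT-BALL
FORM** — module 1's `exists_ne5_substrate_cores_actNorm` (arithmetic letters eliminated) with `hNf` ∕ `hqf` in ambient-ball form, transferred the same
way ⟹ `∃ C₅, NE5 (B13StepOfRecord.outA (slotsOfRecord …) E₀ cB) (B13StepOfRecord.outB (slotsOfRecord …) E₀ cB) W κ θ′ C₅`.  «NE5 ⇐ the instance». -/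
theorem exists_ne5_substrate_cores_actNorm_ambient {W : Set (ℕ → ℝ)} {ROp RHist R' H : ℕ → ℝ}
    {N₀f mf bf : D.carriers.Dom → InnerLabel D.carriers.Dom (Bnd D.toTwoRuns) → ℝ}
    {A' : ℕ → D.carriers.Dom → InnerLabel D.carriers.Dom (Bnd D.toTwoRuns) → ℝ}
    {mstar κ Φ' EA₀ cA c₁ r₀ δ' θ θ' : ℝ}
    (hbB : (assembly (slotsOfRecord D ι c a s P 𝒵 dom Jc V mI L)).SliceBudgetB W κ cB)
    (hbA : (slotsOfRecord D ι c a s P 𝒵 dom Jc V mI L).D.SliceBudget (step (slotsOfRecord D ι c a s P 𝒵 dom Jc V mI L) E₀ cB) W κ cA)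
    (hdA : DecayBound (B13StepOfRecord.outA (slotsOfRecord D ι c a s P 𝒵 dom Jc V mI L) E₀ cB) W EA₀ κ)
    (hdB : DecayBound (B13StepOfRecord.outB (slotsOfRecord D ι c a s P 𝒵 dom Jc V mI L) E₀ cB) W E₀ κ)
    (hRA : RawBounded (slotsOfRecord D ι c a s P 𝒵 dom Jc V mI L).F (assembly (slotsOfRecord D ι c a s P 𝒵 dom Jc V mI L)).rawAt W)
    (hRB : RawBounded (slotsOfRecord D ι c a s P 𝒵 dom Jc V mI L).F (slotsOfRecord D ι c a s P 𝒵 dom Jc V mI L).rawB W)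
    (hwer : WeightedEntrywiseRate (slotsOfRecord D ι c a s P 𝒵 dom Jc V mI L).F (assembly (slotsOfRecord D ι c a s P 𝒵 dom Jc V mI L)).rawAt
      (slotsOfRecord D ι c a s P 𝒵 dom Jc V mI L).rawB W c₁ fun k => θ ^ k)
    (hfl : ∀ k, r₀ ≤ L.rOp k)
    (hins : (step (slotsOfRecord D ι c a s P 𝒵 dom Jc V mI L) E₀ cB).InsertionRate W κ E₀ δ' θ)
    (hOp : ∀ k, L.rOp k ≤ ROp k) (hroom : ∀ k, ROp k < R' k)
    (hHist : ∀ k, (assembly (slotsOfRecord D ι c a s P 𝒵 dom Jc V mI L)).bHist E₀ cB k + L.rHist k ≤ RHist k)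
    (hm : 0 < mstar) (hmf : ∀ Z ℓ, mstar ≤ mf Z ℓ) (hN₀ : ∀ Z ℓ, 0 ≤ N₀f Z ℓ)
    (hNf : ∀ k, ∀ g ∈ W, ∀ (U : D.carriers.BgB) (X : D.carriers.Dom), D.carriers.scale X = k →
      ∀ i, (assembly (slotsOfRecord D ι c a s P 𝒵 dom Jc V mI L)).𝒯.Rel k i X →
      ∀ m : Fin ((assembly (slotsOfRecord D ι c a s P 𝒵 dom Jc V mI L)).𝒯.len i + 1),
      (∀ op ∈ ball (opOf (slotsOfRecord D ι c a s P 𝒵 dom Jc V mI L).F (slotsOfRecord D ι c a s P 𝒵 dom Jc V mI L).rawB g U k) (R' k),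
        AEStronglyMeasurable ((factorCores (assembly (slotsOfRecord D ι c a s P 𝒵 dom Jc V mI L)).𝒯 (coresRec D P 𝒵 dom Jc V mI L) i m).N
          op) (factorCores (assembly (slotsOfRecord D ι c a s P 𝒵 dom Jc V mI L)).𝒯 (coresRec D P 𝒵 dom Jc V mI L) i m).lam) ∧
      (∀ p, DifferentiableOn ℂ (fun op : OpDatum (SpeciesRec D o T ι' Ω 𝒴) =>
          (factorCores (assembly (slotsOfRecord D ι c a s P 𝒵 dom Jc V mI L)).𝒯 (coresRec D P 𝒵 dom Jc V mI L) i m).N op p)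
        (ball (opOf (slotsOfRecord D ι c a s P 𝒵 dom Jc V mI L).F (slotsOfRecord D ι c a s P 𝒵 dom Jc V mI L).rawB g U k) (R' k))) ∧
      (∀ op ∈ ball (opOf (slotsOfRecord D ι c a s P 𝒵 dom Jc V mI L).F (slotsOfRecord D ι c a s P 𝒵 dom Jc V mI L).rawB g U k) (R' k), ∀ p,
        ‖(factorCores (assembly (slotsOfRecord D ι c a s P 𝒵 dom Jc V mI L)).𝒯 (coresRec D P 𝒵 dom Jc V mI L) i m).N op p‖ ≤
          N₀f ((assembly (slotsOfRecord D ι c a s P 𝒵 dom Jc V mI L)).𝒯.poly i m)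
            ((assembly (slotsOfRecord D ι c a s P 𝒵 dom Jc V mI L)).𝒯.lab i m)))
    (hqf : ∀ k, ∀ g ∈ W, ∀ (U : D.carriers.BgB) (X : D.carriers.Dom), D.carriers.scale X = k →
      ∀ i, (assembly (slotsOfRecord D ι c a s P 𝒵 dom Jc V mI L)).𝒯.Rel k i X →
      ∀ m : Fin ((assembly (slotsOfRecord D ι c a s P 𝒵 dom Jc V mI L)).𝒯.len i + 1),
      (∀ op ∈ ball (opOf (slotsOfRecord D ι c a s P 𝒵 dom Jc V mI L).F (slotsOfRecord D ι c a s P 𝒵 dom Jc V mI L).rawB g U k) (R' k),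
        AEStronglyMeasurable (Function.uncurry
          ((factorCores (assembly (slotsOfRecord D ι c a s P 𝒵 dom Jc V mI L)).𝒯 (coresRec D P 𝒵 dom Jc V mI L) i m).q op))
          ((factorCores (assembly (slotsOfRecord D ι c a s P 𝒵 dom Jc V mI L)).𝒯 (coresRec D P 𝒵 dom Jc V mI L) i m).lam.prod volume)) ∧
      (∀ p v, DifferentiableOn ℂ (fun op : OpDatum (SpeciesRec D o T ι' Ω 𝒴) =>
          (factorCores (assembly (slotsOfRecord D ι c a s P 𝒵 dom Jc V mI L)).𝒯 (coresRec D P 𝒵 dom Jc V mI L) i m).q op p v)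
        (ball (opOf (slotsOfRecord D ι c a s P 𝒵 dom Jc V mI L).F (slotsOfRecord D ι c a s P 𝒵 dom Jc V mI L).rawB g U k) (R' k))) ∧
      (∀ op ∈ ball (opOf (slotsOfRecord D ι c a s P 𝒵 dom Jc V mI L).F (slotsOfRecord D ι c a s P 𝒵 dom Jc V mI L).rawB g U k) (R' k), ∀ p v,
        mf ((assembly (slotsOfRecord D ι c a s P 𝒵 dom Jc V mI L)).𝒯.poly i m) ((assembly (slotsOfRecord D ι c a s P 𝒵 dom Jc V mI L)).𝒯.lab i m) *
            ‖v‖ ^ 2 -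
          bf ((assembly (slotsOfRecord D ι c a s P 𝒵 dom Jc V mI L)).𝒯.poly i m) ((assembly (slotsOfRecord D ι c a s P 𝒵 dom Jc V mI L)).𝒯.lab i m) ≤
          ((factorCores (assembly (slotsOfRecord D ι c a s P 𝒵 dom Jc V mI L)).𝒯 (coresRec D P 𝒵 dom Jc V mI L) i m).q op p v).re))
    (hH : ∀ k, ∀ g ∈ W, ∀ U : D.carriers.BgB, ‖(assembly (slotsOfRecord D ι c a s P 𝒵 dom Jc V mI L)).histRef g U k‖ + RHist k ≤ H k)
    (hκ : 0 ≤ κ) (hA0' : ∀ k Z ℓ, 0 ≤ A' k Z ℓ)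
    (hdec : ∀ k Z ℓ, factorMass (coresRec D P 𝒵 dom Jc V mI L) N₀f bf mstar (H k) Z ℓ ≤ A' k Z ℓ * Real.exp (-(κ * (D.carriers.d Z + 5))))
    (hΦ0 : 0 ≤ Φ') (hsmallΦ : 36 * Φ' < 1)
    (hΦ : ∀ (k : ℕ) (q : SCube D.toTwoRuns), ∑ Z ∈ D.toTwoRuns.domAt k,
      ind (q ∈ footprint Z) * actSum (b13InnerData D.toTwoRuns) (A' k) k Z * Real.exp ((footprint Z).card) ≤ Φ')
    (hE₀ : 0 ≤ E₀) (hcA : 0 ≤ cA) (hcB : 0 ≤ cB) (hc₁ : 0 ≤ c₁) (hr₀ : 0 < r₀) (hδ' : 0 ≤ δ')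
    (hθ0 : 0 < θ) (hθ1 : θ < 1) (hθθ' : θ ≤ θ') (hθ'1 : θ' ≤ 1) (hω : 0 < L.ins.ω) (hω1 : L.ins.ω < 1)
    (hh : cA * (EA₀ + E₀) < 1 - L.ins.ω)
    (hsmall : L.ins.ω + Φ' / (1 - 36 * Φ') * cA * (1 - L.ins.ω) / (1 - L.ins.ω - cA * (EA₀ + E₀)) < θ') :
    ∃ C₅, NE5 (B13StepOfRecord.outA (slotsOfRecord D ι c a s P 𝒵 dom Jc V mI L) E₀ cB)
      (B13StepOfRecord.outB (slotsOfRecord D ι c a s P 𝒵 dom Jc V mI L) E₀ cB) W κ θ' C₅ :=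
  exists_ne5_substrate_cores_actNorm D ι c a s P 𝒵 dom Jc V mI L hbdA hmQA hmRA hbdB hmQB hmRB iopAt hiopA E₀ cB hbB hbA hdA hdB hRA hRB
    hwer hfl hins hOp hroom hHist hm hmf hN₀
    (fun k g hg U X hX i hi m => by
      obtain ⟨h₁, h₂, h₃⟩ := hNf k g hg U X hX i hi m
      exact ⟨fun op hop => h₁ _ ((mem_ball_mk_iff _ _ op).1 hop), fun p => differentiableOn_coe_of_ball _ _ (h₂ p),
        fun op hop p => h₃ _ ((mem_ball_mk_iff _ _ op).1 hop) p⟩)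
    (fun k g hg U X hX i hi m => by
      obtain ⟨h₁, h₂, h₃⟩ := hqf k g hg U X hX i hi m
      exact ⟨fun op hop => h₁ _ ((mem_ball_mk_iff _ _ op).1 hop), fun p v => differentiableOn_coe_of_ball _ _ (h₂ p v),
        fun op hop p v => h₃ _ ((mem_ball_mk_iff _ _ op).1 hop) p v⟩)
    hH hκ hA0' hdec hΦ0 hsmallΦ hΦ hE₀ hcA hcB hc₁ hr₀ hδ' hθ0 hθ1 hθθ' hθ'1 hω hω1 hh hsmall

end Instance

end Summit.QuantumFields.BalabanUV.T4Continuum.B13AssemblyCoresEndSubstrateAmbient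

end
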